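import Mathlib.LinearAlgebra.Complex.FiniteDimensional
import Literature.MathematicalPhysics.QuantumFieldTheory.Balaban1983to89.Node00.Record12NumericsFamilyDict
import Literature.MathematicalPhysics.QuantumFieldTheory.Balaban1983to89.Node00.Record13NumericsOfThm1CCM

/-!
# NODE 00 (YM-PLAN Track A) — THE COEFFICIENT ALGEBRA OF THE DICTIONARY OF RECORD IS FINITE-DIMENSIONAL, STATED RE-KEY-NEUTRALLY:
# `finiteDimensional_𝔸_stage3OfFamily F : FiniteDimensional ℝ (stage3OfFamily F).𝔸` (and at `stage3OfRecord₁₂`, and over `ℂ`) — ONE by-name lemma for the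
# six N24 K1-face junction files, valid at today's record `𝔸 := ℂ` AND at the re-keyed record `𝔸 := Matrix (Fin 2) (Fin 2) ℂ`

Cell `pub-ymgap`, seat `pub-ymgap-node00-def-RR-2` (g20; FLAG №14 «RECORD-ABELIAN», director-ym №256 (2) RECORD-NONABELIAN RE-KEY; plan g91 SIZING WORD
road α, STEP 0 (α); director-ym №258 (i)(α) «GO on step 0 NOW … + the `rfl` transport for `theta13OfThm1CCM … .toStage3Params.𝔸`» — the plan's
farm-checked stencil `pub-ymgap-plan/D91-F14/FiniteDimStage3OfFamily-stencil.lean` 87bbd7de174943ae, typed as a Node00 leaf).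
[I] = [Balaban1987RG1], [B6] = [Balaban1984PropagatorsII], [B8] = [Balaban1985RegularSpaces].

WHY.  The six N24 K1-face junction files (`Theorems/BalabanUVNodesN24K1FaceN05JunctionSlot8KappaPrimeAtGaussPinZ` :210, `…N05JunctionLSlot8KappaPrimeAtGaussPinZ`
:210, `…PinPrintedZ` :210, `…PinPrintedZYP` :210, `…N06BindersJunctionLSlot8KappaPrimeAtGaussPinPrintedZYP` :201, `…N06BindersEtaLawJunction…PrintedZYP` :202)
discharge node N05's binder `[FiniteDimensional ℝ θ.𝔸]` AT THE FAMILY DICTIONARY by `haveI : FiniteDimensional ℝ (stage3OfFamily F).𝔸 := by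
show FiniteDimensional ℝ ℂ; infer_instance` — the ONLY place their elaboration reads the definitional equation `stage3OfRecord₁₂.𝔸 = ℂ`.  The re-key
edition of `Record12Numerics` (`𝔸 := Matrix (Fin 2) (Fin 2) ℂ`, [B8] p. 77 «values in G ⊂ M_N(ℂ)», [I] (0.1)) breaks exactly that `show`.  This leaf states the
fact ONCE, BY NAME, with the carrier-blind proof `by unfold stage3OfFamily stage3OfRecord₁₂; infer_instance` — it names neither `ℂ` nor `M₂(ℂ)`, elaborates
at today's record AND at the re-keyed record (node00-def-RR-2's probe `FinDimVariants.lean`, farm rc 0 in both worlds; the plan's two-branch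
`first | (show … ℂ; …) | (show … (Matrix (Fin 2) (Fin 2) ℂ); …)` stencil does the same but trips `linter.unreachableTactic`), so the lemma — and every consumer
re-pointed to it — SURVIVES THE RE-KEY UNCHANGED (plan g91 (4) step 0: «0 same-hour breaks in group (a)»).  Every Stage-12∕13 pin is `{ … with }` over `stage3OfFamily F`, so at a pin
`θ` the instance is `finiteDimensional_𝔸_stage3OfFamily F` by `exact` (definitional unfolding of `θ.toStage3Params.𝔸`); for the K0⁷ family of record
`theta13OfThm1CCM F N j ε₀ ε₂₉ B₃ B₃' a₀ a₁` (`Record13NumericsOfThm1CCM` §2) the transport is displayed: `theta13OfThm1CCM_𝔸 : (…).toStage3Params.𝔸 =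
(stage3OfFamily F).𝔸 := rfl` and `finiteDimensional_𝔸_theta13OfThm1CCM`.

WHAT THIS FILE PROVIDES.  §1 ★ `finiteDimensional_𝔸_stage3OfFamily` · `finiteDimensional_𝔸_stage3OfRecord₁₂` (over `ℝ`, the N05 binder) ·
`finiteDimensionalC_𝔸_stage3OfFamily` · `finiteDimensionalC_𝔸_stage3OfRecord₁₂` (over `ℂ`, for traces `τ : θ.𝔸 →ₗ[ℂ] ℂ`); §2 the transport to the K0⁷
family of record: `theta13OfThm1CCM_𝔸` (`rfl`) · `finiteDimensional_𝔸_theta13OfThm1CCM` · `finiteDimensionalC_𝔸_theta13OfThm1CCM`.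

## HONEST FRAMING — what this is NOT

* Linear-algebra bookkeeping about the dictionary's coefficient algebra (`ℂ` today, `M₂(ℂ)` after the re-key — both finite-dimensional); nothing of
  Bałaban's is asserted; no proviso, key, datum key or pin is touched; K0⁷ is NOT inhabited; no node count and no K-display moves; COUNT-NEUTRAL.
* One finite four-torus programme at fixed `ε = L^{−K}` — NOT the continuum limit on ℝ⁴, NOT infinite volume, NOT OS, NOT a mass gap, NOT the Clay problem.
  No `sorry`, no `axiom`, no `instance`, no `notation`.
-/

noncomputable section

namespace Literature.MathematicalPhysics.QuantumFieldTheory.Balaban1983to89.Node00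

open T4Continuum


/-! ## §1. The coefficient algebra of the dictionary (of the family ∕ of record) is finite-dimensional — two-branch, re-key-neutral -/

/-- ★ **The coefficient algebra of the family dictionary is finite-dimensional over `ℝ`** — node N05's binder `[FiniteDimensional ℝ θ.𝔸]` at `θ := stage3OfFamily F`,
proved carrier-blind (`unfold …; infer_instance`), so that it elaborates at `𝔸 := ℂ` (today) and at `𝔸 := Matrix (Fin 2) (Fin 2) ℂ` (the RECORD-NONABELIAN re-key) alike.
[cite: Balaban1985RegularSpaces, p.77 («gauge field configurations with values in G ⊂ M_N(ℂ)»); Balaban1987RG1, (0.1) p.251 (bookkeeping: the dictionary's coefficient algebra)] -/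
theorem finiteDimensional_𝔸_stage3OfFamily (F : T4Family) : FiniteDimensional ℝ (stage3OfFamily F).𝔸 := by
  unfold stage3OfFamily stage3OfRecord₁₂; infer_instance

/-- The same at the dictionary of record `stage3OfRecord₁₂` (`L = 3`). [cite: Balaban1985RegularSpaces, p.77; Balaban1987RG1, (0.1) p.251 (bookkeeping)] -/
theorem finiteDimensional_𝔸_stage3OfRecord₁₂ : FiniteDimensional ℝ stage3OfRecord₁₂.𝔸 := by
  unfold stage3OfRecord₁₂; infer_instance

/-- **… and finite-dimensional over `ℂ`** (the module structure of the carried C⋆-algebra `θ.instCStar`), for consumers that trace `θ.𝔸 →ₗ[ℂ] ℂ`.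
[cite: Balaban1985RegularSpaces, p.77; Balaban1987RG1, (0.1) p.251 (bookkeeping)] -/
theorem finiteDimensionalC_𝔸_stage3OfFamily (F : T4Family) : FiniteDimensional ℂ (stage3OfFamily F).𝔸 := by
  unfold stage3OfFamily stage3OfRecord₁₂; infer_instance

/-- The same at `stage3OfRecord₁₂`. [cite: Balaban1985RegularSpaces, p.77; Balaban1987RG1, (0.1) p.251 (bookkeeping)] -/
theorem finiteDimensionalC_𝔸_stage3OfRecord₁₂ : FiniteDimensional ℂ stage3OfRecord₁₂.𝔸 := by
  unfold stage3OfRecord₁₂; infer_instance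


/-! ## §2. Transport to the K0⁷ family of record `theta13OfThm1CCM F N j ε₀ ε₂₉ B₃ B₃' a₀ a₁` (a `{ … with }` pin over `stage3OfFamily F`) -/

section Thm1CCM

variable (F : T4Family) (N : ℕ) [NeZero N] (j : ℕ) (ε₀ ε₂₉ B₃ B₃' a₀ a₁ : ℝ)

/-- The K0⁷ family of record has the family dictionary's coefficient algebra (`rfl`: the pins are `{ … with }` over `stage3OfFamily F`).
[cite: Balaban1987RG1, (0.21) p.256; Balaban1988Convergent, (2.10) p.256 (bookkeeping)] -/
theorem theta13OfThm1CCM_𝔸 : (theta13OfThm1CCM F N j ε₀ ε₂₉ B₃ B₃' a₀ a₁).toStage3Params.𝔸 = (stage3OfFamily F).𝔸 := rfl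

/-- … hence finite-dimensional over `ℝ` (node N05's binder at the K0⁷ family of record). [cite: Balaban1985RegularSpaces, p.77; Balaban1987RG1, (0.1) p.251 (bookkeeping)] -/
theorem finiteDimensional_𝔸_theta13OfThm1CCM : FiniteDimensional ℝ (theta13OfThm1CCM F N j ε₀ ε₂₉ B₃ B₃' a₀ a₁).toStage3Params.𝔸 :=
  finiteDimensional_𝔸_stage3OfFamily F

/-- … and over `ℂ`. [cite: Balaban1985RegularSpaces, p.77; Balaban1987RG1, (0.1) p.251 (bookkeeping)] -/
theorem finiteDimensionalC_𝔸_theta13OfThm1CCM : FiniteDimensional ℂ (theta13OfThm1CCM F N j ε₀ ε₂₉ B₃ B₃' a₀ a₁).toStage3Params.𝔸 :=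
  finiteDimensionalC_𝔸_stage3OfFamily F

end Thm1CCM

end Literature.MathematicalPhysics.QuantumFieldTheory.Balaban1983to89.Node00

end
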